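import Mathlib.Algebra.MvPolynomial.Expand
import Mathlib.Algebra.MvPolynomial.CommRing
import Mathlib.Algebra.CharP.Basic
import Mathlib.Algebra.BigOperators.Fin
import Mathlib.Data.Fin.VecNotation
import HarnessLib

/-!
# A kernel-decidable certificate kit for the uniform Fedder cells `KLocCell` (crux `FInjectiveMacaulayfication`, road B / G2–G3)

[OURS · L1 W4.5a] Support file for crux stmt-ResolutionOfSingularities-15315 (seat table v13, stub-6; planner rulings R12.11(d) /
R12.12(b): «pilot G2 cell … report elaboration seconds — this number decides road B's feasibility»).  The G2 cell of
`L/w45a/ToricCertSig.lean` v1.2 §2/§3 (typed by res-L1-w45a-stub-1 as `KLocCell`) asks, per chart polynomial `g` and stratum `S`, for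
a distinct-residue p-th-root SPLIT `g^(p-1) = Σ_e Y^{e.1} · expand p e.2` and COFACTORS `1 = Σ rr_e · expand p e.2 + Σ_{i∈S} t i · Y_i + t₀ · g`.
For `T⁽⁴⁾` at `p = 7` the polynomial `g^6` has 966 terms (528 residue classes) on each of the 537 charts — far beyond `ring`.
This file is a small COMPUTABLE sparse-polynomial arithmetic on term lists `(c, e) : ℤ × (Fin n → ℕ)` (the currency of `CIPolyKit`),
internally keyed `(c, key e, e)` (the key only orders and pre-filters; soundness never uses it): merge-based normalising product
`mulK` (structural `mergeFK` with fuel, `collectK`), power `powK`, Frobenius `expandK`, the residue split `splitK`, the cofactor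
normal form `cofactorNFK`, the Boolean checks `checkK` (one stratum) / `checkKs` (all strata of a chart: ONE split), and the
semantics `evalL` / `evalK` into `MvPolynomial (Fin n) K`.  SOUNDNESS (`klocCell_of_check`, `klocCells_of_check`: the check `= true` —
one `decide` — yields the §3 per-stratum binder `∃ L rr t t₀, (L.map Prod.fst).Nodup ∧ (∀ e ∈ L, ∀ i, e.1 i < p) ∧ g^(p-1) = … ∧ 1 = …`
VERBATIM for `g = evalL K G`) is the companion file `…KLocCellSound.lean`.  The split is never typed as data: the kernel computes it
(pilot: one `T⁽⁴⁾/7` cell in ≈ 45 s, default heartbeats), so an instance file carries only `g` (8 terms) and the cofactors.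
Definitions are computable list programs (no instances, no notation); AI-written, weaker than expert review; no statement of
[claim: Hironaka2017] is used. [folklore]
-/

-- single-problem summit: the doubled namespace component is forced
set_option linter.dupNamespace false

namespace Summit.ResolutionOfSingularities.ResolutionOfSingularities.Theorems.FInjectiveMacaulayfication.KLocCellKit

open MvPolynomial

variable {n : ℕ}

/-! ## The list programs (keyed terms `(c, k, e) : ℤ × ℕ × (Fin n → ℕ)`) -/

/-- A base-`2^20` key of an exponent vector; used ONLY to order and pre-filter. [folklore] -/
def key (e : Fin n → ℕ) : ℕ := (List.finRange n).foldr (fun i acc => e i + 1048576 * acc) 0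

/-- Attach keys to a term list. [folklore] -/
def withKey (L : List (ℤ × (Fin n → ℕ))) : List (ℤ × ℕ × (Fin n → ℕ)) := L.map fun t => (t.1, key t.2, t.2)

/-- Multiply every keyed term of a list by one keyed term. [folklore] -/
def shiftK (s : ℤ × ℕ × (Fin n → ℕ)) (L : List (ℤ × ℕ × (Fin n → ℕ))) : List (ℤ × ℕ × (Fin n → ℕ)) :=
  L.map fun t => (s.1 * t.1, s.2.1 + t.2.1, s.2.2 + t.2.2)

/-- Combine ADJACENT terms with equal exponents (a full normal form when the list is sorted). [folklore] -/
def collectK : List (ℤ × ℕ × (Fin n → ℕ)) → List (ℤ × ℕ × (Fin n → ℕ))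
  | [] => []
  | t :: L =>
    match collectK L with
    | [] => [t]
    | t' :: L' => if t.2.1 = t'.2.1 ∧ t.2.2 = t'.2.2 then (t.1 + t'.1, t'.2) :: L' else t :: t' :: L'

/-- Merge by key, structurally recursive on a fuel argument (exhausted fuel appends). [folklore] -/
def mergeFK : ℕ → List (ℤ × ℕ × (Fin n → ℕ)) → List (ℤ × ℕ × (Fin n → ℕ)) → List (ℤ × ℕ × (Fin n → ℕ))
  | 0, L, M => L ++ M
  | _ + 1, [], M => M
  | _ + 1, t :: L, [] => t :: L
  | f + 1, t :: L, t' :: M => if t.2.1 ≤ t'.2.1 then t :: mergeFK f L (t' :: M) else t' :: mergeFK f (t :: L) M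

/-- Normalising product of keyed term lists. [folklore] -/
def mulK (A B : List (ℤ × ℕ × (Fin n → ℕ))) : List (ℤ × ℕ × (Fin n → ℕ)) :=
  A.foldr (fun s acc => collectK (mergeFK (B.length + acc.length + 1) (shiftK s B) acc)) []

/-- Normalising power of a keyed term list. [folklore] -/
def powK (G : List (ℤ × ℕ × (Fin n → ℕ))) : ℕ → List (ℤ × ℕ × (Fin n → ℕ))
  | 0 => [(1, 0, 0)]
  | m + 1 => mulK G (powK G m)

/-- Frobenius on exponents: `Y^e ↦ Y^(p e)`. [folklore] -/
def expandK (p : ℕ) (L : List (ℤ × ℕ × (Fin n → ℕ))) : List (ℤ × ℕ × (Fin n → ℕ)) :=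
  L.map fun t => (t.1, p * t.2.1, p • t.2.2)

/-- Insert the term `c · Y^(α + p q)` into a residue-grouped list (groups `(key α, α, s_α)` ordered by key). [folklore] -/
def splitInsK (kα : ℕ) (α : Fin n → ℕ) (q : ℤ × ℕ × (Fin n → ℕ)) :
    List (ℕ × (Fin n → ℕ) × List (ℤ × ℕ × (Fin n → ℕ))) → List (ℕ × (Fin n → ℕ) × List (ℤ × ℕ × (Fin n → ℕ)))
  | [] => [(kα, α, [q])]
  | g :: gs => if kα = g.1 ∧ α = g.2.1 then (g.1, g.2.1, q :: g.2.2) :: gs else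
      if kα < g.1 then (kα, α, [q]) :: g :: gs else g :: splitInsK kα α q gs

/-- The residue split of a keyed term list: groups `(key α, α, s_α)` with `Σ_terms = Σ_α Y^α · (s_α)(Y^p)`, `α < p`. [folklore] -/
def splitK (p : ℕ) (L : List (ℤ × ℕ × (Fin n → ℕ))) : List (ℕ × (Fin n → ℕ) × List (ℤ × ℕ × (Fin n → ℕ))) :=
  L.foldr (fun t gs => splitInsK (key fun i => t.2.2 i % p) (fun i => t.2.2 i % p)
    (t.1, key fun i => t.2.2 i / p, fun i => t.2.2 i / p) gs) []

/-- Look up the cofactor list attached to a residue `α` (default: none). [folklore] -/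
def lookupRK (R : List ((Fin n → ℕ) × List (ℤ × (Fin n → ℕ)))) (kα : ℕ) (α : Fin n → ℕ) : List (ℤ × ℕ × (Fin n → ℕ)) :=
  match R.find? (fun r => decide (key r.1 = kα ∧ r.1 = α)) with
  | some r => withKey r.2
  | none => []

/-- Accumulate a normalised list into a running normal form. [folklore] -/
def addNFK (P acc : List (ℤ × ℕ × (Fin n → ℕ))) : List (ℤ × ℕ × (Fin n → ℕ)) :=
  collectK (mergeFK (P.length + acc.length + 1) P acc)

/-- Normal form of `Σ_α r_α · expand p s_α + Σ_{i ∈ S} t_i · Y_i + t₀ · g − 1` for the split groups `gs`. [folklore] -/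
def cofactorNFK (p : ℕ) (GK : List (ℤ × ℕ × (Fin n → ℕ))) (S : Finset (Fin n))
    (gs : List (ℕ × (Fin n → ℕ) × List (ℤ × ℕ × (Fin n → ℕ)))) (R : List ((Fin n → ℕ) × List (ℤ × (Fin n → ℕ))))
    (T : Fin n → List (ℤ × (Fin n → ℕ))) (T₀ : List (ℤ × (Fin n → ℕ))) : List (ℤ × ℕ × (Fin n → ℕ)) :=
  addNFK [(-1, 0, 0)] (addNFK (mulK (withKey T₀) GK)
    ((List.finRange n).foldr
      (fun i acc => if i ∈ S then addNFK (mulK (withKey (T i)) [(1, key (Pi.single i 1 : Fin n → ℕ), Pi.single i 1)]) acc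
        else acc)
      (gs.foldr (fun g acc => addNFK (mulK (lookupRK R g.1 g.2.1) (expandK p g.2.2)) acc) [])))

/-- Pairwise distinctness of a list of keys. [folklore] -/
def pwDistinct : List ℕ → Bool
  | [] => true
  | k :: ks => (ks.all fun k' => k' != k) && pwDistinct ks

/-- **THE ONE BOOLEAN CHECK** of a G2 cell: distinct residue keys of the split of `g^(p-1)` and vanishing (mod `p`) of the
cofactor normal form. [folklore] -/
def checkK (p : ℕ) (G : List (ℤ × (Fin n → ℕ))) (S : Finset (Fin n)) (R : List ((Fin n → ℕ) × List (ℤ × (Fin n → ℕ))))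
    (T : Fin n → List (ℤ × (Fin n → ℕ))) (T₀ : List (ℤ × (Fin n → ℕ))) : Bool :=
  let gs := splitK p (powK (withKey G) (p - 1))
  pwDistinct (gs.map fun g => g.1) && (cofactorNFK p (withKey G) S gs R T T₀).all fun t => decide ((p : ℤ) ∣ t.1)

/-- The Boolean check of ALL cells of one chart (one split, several cofactor identities): data `(S, R, T, T₀)` per stratum. [folklore] -/
def checkKs (p : ℕ) (G : List (ℤ × (Fin n → ℕ)))
    (cells : List (Finset (Fin n) × List ((Fin n → ℕ) × List (ℤ × (Fin n → ℕ))) × (Fin n → List (ℤ × (Fin n → ℕ))) ×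
      List (ℤ × (Fin n → ℕ)))) : Bool :=
  let GK := withKey G
  let gs := splitK p (powK GK (p - 1))
  pwDistinct (gs.map fun g => g.1) &&
    cells.all fun c => (cofactorNFK p GK c.1 gs c.2.1 c.2.2.1 c.2.2.2).all fun t => decide ((p : ℤ) ∣ t.1)

/-! ## Semantics and soundness -/

variable (K : Type) [Field K]

/-- The value of a term list in `K[Y]` (the currency of `CIPolyKit`, written as a definition). [folklore] -/
noncomputable def evalL (L : List (ℤ × (Fin n → ℕ))) : MvPolynomial (Fin n) K :=
  (L.map fun t : ℤ × (Fin n → ℕ) => (monomial (Finsupp.equivFunOnFinite.symm t.2) ((t.1 : ℤ) : K) : MvPolynomial (Fin n) K)).sum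

/-- The value of a keyed term list in `K[Y]` (keys are ignored). [folklore] -/
noncomputable def evalK (L : List (ℤ × ℕ × (Fin n → ℕ))) : MvPolynomial (Fin n) K :=
  (L.map fun t : ℤ × ℕ × (Fin n → ℕ) =>
    (monomial (Finsupp.equivFunOnFinite.symm t.2.2) ((t.1 : ℤ) : K) : MvPolynomial (Fin n) K)).sum

end Summit.ResolutionOfSingularities.ResolutionOfSingularities.Theorems.FInjectiveMacaulayfication.KLocCellKit
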